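import Summits.HodgeConjecture.HodgeConjecture.Theorems.LinearSystemTorelliLocalTubeSpanFrameLiftBasic
import Summits.HodgeConjecture.HodgeConjecture.Theorems.LinearSystemTorelliLocalTubeSpanPlaneCalculus
import Summits.HodgeConjecture.HodgeConjecture.Theorems.LinearSystemTorelliLocalTubeSpanEuclidGame
import Summits.HodgeConjecture.HodgeConjecture.Theorems.LinearSystemTorelliLocalTubeSpanCoprimeShift
import Summits.HodgeConjecture.HodgeConjecture.Theorems.LinearSystemTorelliLocalTubeSpanUnimodularTransitivityLemmas
import Mathlib.Tactic.Module
import Mathlib.RingTheory.Coprime.Lemmas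

/-!
# Route LinearSystemTorelli — crux `LocalTubeSpan` (stmt-HodgeConjecture-2490): unimodular transitivity of the level-2 elementary moves, LOCAL hypotheses — lemmas

Helper file (`--supports stmt-HodgeConjecture-2490`, line `Sketch` of the crux chain, cycle 8,
worker D: local hypotheses; continuation lead c7; first half of the lead's stub
`stub_unimodularTransitivityLocal` — the main theorem is in `…UnimodularTransitivityLocal`).  This is
cycle 7's `…UnimodularTransitivityLemmas` re-proved with the move hypotheses required ONLY where its
proof uses them: the pair moves `E_{e,f}²` at `e ∈ {x, y}` and the squares `T_a²` at
`a ∈ {x, y, x + y}` (displayed as explicit binders `hpair`, `hsq` of every statement).  THIS FILE: the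
reachable pairs `(1,0)`, `(-1,0)` and every COPRIME pair `(A, β)` (the Euclid game); integrality on
`ℤΔ`, the pair move (isometry, lattice) and the pull-back of reachability are imported from
`…UnimodularTransitivityLemmas`.

Let `Λ = ℤΔ` be a lattice in the `ℚ`-space `V` on which the alternating form `B` is integral, let
`x, y ∈ Λ` with `⟨x, y⟩ = 1`, and let `Γ ≤ GL(V)` contain the squared transvection pairs
`E_{e,f}² : v ↦ v + 2(⟨v,e⟩f + ⟨v,f⟩e)` for `e ∈ {x, y}`, `f ∈ Λ`, `⟨e, f⟩ = 0`, and the squares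
`T_a² : v ↦ v - 2⟨v,a⟩a` for `a ∈ {x, y, x + y}` — for the monodromy group `Γ_Δ` of a skew vanishing
lattice and a base pair `x, y ∈ Δ` these memberships are supplied in cycle 8 WITHOUT Janssen's
Theorem 2.5.  MAIN THEOREM `localTubeSpan_unimodularTransitivity_local` (next file): every
UNIMODULAR `t ∈ x + 2Λ` (`⟨t, y'⟩ = 1` for some `y' ∈ Λ`) is `g x` for some `g ∈ Γ` — the content of
Janssen's Theorem 2.9, thereby unconditional.

Proof (coordinates `A = ⟨t, y⟩`, odd, and `β = ⟨z, x⟩` for `t = x + 2z`):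
* `(A, β) = (1, 0)`: `t = E_{y,z}² x` (`localTubeSpan_reach_of_one_zero_local`);
* `(A, β) = (-1, 0)`: the word `T_x² T_y² T_{x+y}²` is `-1` on the plane `(x, y)` and `1` on its
  orthogonal (`…PlaneCalculus`), moving `t` to the previous case
  (`localTubeSpan_reach_of_neg_one_zero_local`);
* `(A, β)` coprime: powers of `T_y²` (`β ↦ β ∓ kA`) and of `T_x²` (`A ↦ A ∓ 4kβ`) play the Euclid
  game of `…EuclidGame` down to `(±1, 0)` (`localTubeSpan_reach_of_isCoprime_local`).

No named facts (the two move families are hypotheses); no `sorry`.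
-/

-- `Summit.HodgeConjecture.HodgeConjecture.Theorems` is the mandated namespace (single-conjunct summit:
-- Sub = Summit), which `linter.dupNamespace` flags on every declaration; the lakefile turns the
-- linter off tree-wide (weak option), restated here so stand-alone elaboration is warning-free too.

set_option linter.dupNamespace false

noncomputable section

open Literature.AlgebraicGeometry.HodgeTheory

namespace Summit.HodgeConjecture.HodgeConjecture.Theorems

variable {V : Type} [AddCommGroup V] [Module ℚ V]

/-! ### Reachability from `x` by the local moves of `Γ` -/

section ReachLocal

variable (B : LinearMap.BilinForm ℚ V) (Δ : Set V) (Γ : Subgroup (V →ₗ[ℚ] V)ˣ) {x y : V}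

/-- The pair `(A, β) = (1, 0)`: `t = x + 2z` with `⟨t, y⟩ = 1`, `⟨t, x⟩ = 0` is `E_{y,z}² x` (pair
move at `e = y`). [folklore] -/
theorem localTubeSpan_reach_of_one_zero_local (hB : B.IsAlt) (hxy : B x y = 1)
    (hpair : ∀ e ∈ ({x, y} : Set V), ∀ f ∈ Submodule.span ℤ Δ, B e f = 0 →
      ∃ g ∈ Γ, ∀ v : V, ((g : (V →ₗ[ℚ] V)ˣ) : V →ₗ[ℚ] V) v = v + (2 : ℚ) • (B v e • f + B v f • e))
    {t z : V} (hz : z ∈ Submodule.span ℤ Δ)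
    (ht : t = x + (2 : ℚ) • z) (hty : B t y = 1) (htx : B t x = 0) :
    ∃ g ∈ Γ, ((g : (V →ₗ[ℚ] V)ˣ) : V →ₗ[ℚ] V) x = t := by
  have hzy : B z y = 0 := by
    have h := hty
    rw [ht, map_add, map_smul, LinearMap.add_apply, LinearMap.smul_apply, hxy, smul_eq_mul] at h
    linarith
  have hzx : B z x = 0 := by
    have h := htx
    rw [ht, map_add, map_smul, LinearMap.add_apply, LinearMap.smul_apply, hB.self_eq_zero,
      smul_eq_mul] at h
    linarith
  have hyz : B y z = 0 := by rw [← hB.neg_eq, hzy, neg_zero]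
  have hxz : B x z = 0 := by rw [← hB.neg_eq, hzx, neg_zero]
  obtain ⟨g, hg, hgf⟩ := hpair y (by simp) z hz hyz
  refine ⟨g, hg, ?_⟩
  rw [hgf, hxy, hxz, ht]
  module

/-- The pair `(A, β) = (-1, 0)`: the word `T_x² T_y² T_{x+y}²` (square moves at `x`, `y`, `x + y`)
acts as `-1` on the plane and moves `t` to `t + 2x`, which has the pair `(1, 0)`. [folklore] -/
theorem localTubeSpan_reach_of_neg_one_zero_local (hB : B.IsAlt) (hxy : B x y = 1)
    (hpair : ∀ e ∈ ({x, y} : Set V), ∀ f ∈ Submodule.span ℤ Δ, B e f = 0 →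
      ∃ g ∈ Γ, ∀ v : V, ((g : (V →ₗ[ℚ] V)ˣ) : V →ₗ[ℚ] V) v = v + (2 : ℚ) • (B v e • f + B v f • e))
    (hsq : ∀ a ∈ ({x, y, x + y} : Set V), ∃ g ∈ Γ, ∀ v : V,
      ((g : (V →ₗ[ℚ] V)ˣ) : V →ₗ[ℚ] V) v = v - (2 : ℚ) • (B v a • a))
    (hx : x ∈ Submodule.span ℤ Δ) {t z : V} (hz : z ∈ Submodule.span ℤ Δ)
    (ht : t = x + (2 : ℚ) • z) (hty : B t y = -1) (htx : B t x = 0) :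
    ∃ g ∈ Γ, ((g : (V →ₗ[ℚ] V)ˣ) : V →ₗ[ℚ] V) x = t := by
  obtain ⟨gx, hgx, hgxf⟩ := hsq x (by simp)
  obtain ⟨gy, hgy, hgyf⟩ := hsq y (by simp)
  obtain ⟨gxy, hgxy, hgxyf⟩ := hsq (x + y) (by simp)
  -- the word acts as `v ↦ v - 2(⟨v,y⟩x - ⟨v,x⟩y)`
  have hword : ∀ v, ((gx * gy * gxy : (V →ₗ[ℚ] V)ˣ) : V →ₗ[ℚ] V) v =
      v - (2 : ℚ) • (B v y • x - B v x • y) := by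
    intro v
    rw [Units.val_mul, Units.val_mul, Module.End.mul_apply, Module.End.mul_apply, hgxyf, hgyf,
      hgxf, ← localTubeSpan_skewTransvection_sq_apply B hB (x + y) v,
      ← localTubeSpan_skewTransvection_sq_apply B hB y,
      ← localTubeSpan_skewTransvection_sq_apply B hB x]
    exact (localTubeSpan_planeCalculus B hB).1 x y hxy v
  have hg0 : gx * gy * gxy ∈ Γ := Γ.mul_mem (Γ.mul_mem hgx hgy) hgxy
  refine localTubeSpan_reach_of_reach_apply Γ hg0 ?_
  refine localTubeSpan_reach_of_one_zero_local B Δ Γ hB hxy hpair (z := z + x)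
    (Submodule.add_mem _ hz hx) ?_ ?_ ?_
  · rw [hword, hty, htx, ht]; module
  · rw [hword, hty, htx, map_sub, map_smul, LinearMap.sub_apply, LinearMap.smul_apply, hty,
      map_sub, map_smul, map_smul, LinearMap.sub_apply, LinearMap.smul_apply,
      LinearMap.smul_apply, hxy, hB.self_eq_zero]
    norm_num
  · rw [hword, hty, htx, map_sub, map_smul, LinearMap.sub_apply, LinearMap.smul_apply, htx,
      map_sub, map_smul, map_smul, LinearMap.sub_apply, LinearMap.smul_apply,
      LinearMap.smul_apply, hB.self_eq_zero, show B y x = -1 by rw [← hB.neg_eq, hxy]]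
    norm_num

/-- The COPRIME case: `t = x + 2z` with `(⟨t, y⟩, ⟨z, x⟩) = (A, β)` coprime is reachable — the Euclid
game on `(A, β)` played with powers of the square moves `T_y²` (`β ↦ β ∓ kA`) and `T_x²`
(`A ↦ A ∓ 4kβ`) down to `(±1, 0)`. [folklore] -/
theorem localTubeSpan_reach_of_isCoprime_local (hB : B.IsAlt)
    (hint : ∀ δ ∈ Δ, ∀ δ' ∈ Δ, ∃ n : ℤ, B δ δ' = n) (hxy : B x y = 1)
    (hpair : ∀ e ∈ ({x, y} : Set V), ∀ f ∈ Submodule.span ℤ Δ, B e f = 0 →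
      ∃ g ∈ Γ, ∀ v : V, ((g : (V →ₗ[ℚ] V)ˣ) : V →ₗ[ℚ] V) v = v + (2 : ℚ) • (B v e • f + B v f • e))
    (hsq : ∀ a ∈ ({x, y, x + y} : Set V), ∃ g ∈ Γ, ∀ v : V,
      ((g : (V →ₗ[ℚ] V)ˣ) : V →ₗ[ℚ] V) v = v - (2 : ℚ) • (B v a • a))
    (hx : x ∈ Submodule.span ℤ Δ) (hy : y ∈ Submodule.span ℤ Δ)
    {t z : V} (hz : z ∈ Submodule.span ℤ Δ) (ht : t = x + (2 : ℚ) • z)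
    {A β : ℤ} (htA : B t y = A) (hzβ : B z x = β) (hcop : IsCoprime A β) :
    ∃ g ∈ Γ, ((g : (V →ₗ[ℚ] V)ˣ) : V →ₗ[ℚ] V) x = t := by
  have hyx : B y x = -1 := by rw [← hB.neg_eq, hxy]
  -- `A` is odd
  have hAodd : Odd A := by
    obtain ⟨n, hn⟩ := localTubeSpan_integral_span B Δ hint hz hy
    have h : (A : ℚ) = 2 * n + 1 := by
      rw [← htA, ht, map_add, map_smul, LinearMap.add_apply, LinearMap.smul_apply, hxy, hn,
        smul_eq_mul]
      ring
    exact ⟨n, by exact_mod_cast h⟩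
  obtain ⟨gx, hgx, hgxf⟩ := hsq x (by simp)
  obtain ⟨gy, hgy, hgyf⟩ := hsq y (by simp)
  have hPx := (localTubeSpan_planeCalculus B hB).2 x gx hgxf
  have hPy := (localTubeSpan_planeCalculus B hB).2 y gy hgyf
  refine localTubeSpan_euclidGame
    (fun A β => ∀ t z : V, z ∈ Submodule.span ℤ Δ → t = x + (2 : ℚ) • z → B t y = A →
      B z x = β → ∃ g ∈ Γ, ((g : (V →ₗ[ℚ] V)ˣ) : V →ₗ[ℚ] V) x = t)
    ?_ ?_ ?_ ?_ A β hAodd hcop t z hz ht htA hzβ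
  · -- `β ↦ β + kA` by powers of `T_y²`
    intro A β k hP t z hz ht htA hzβ
    rcases Int.eq_nat_or_neg k with ⟨m, rfl | rfl⟩
    · -- `k = m`: apply `(T_y²)^{-m}`, which adds `2mA y`
      refine localTubeSpan_reach_of_reach_apply Γ (Γ.pow_mem (Γ.inv_mem hgy) m) ?_
      refine hP _ (z + (((m : ℤ) * A : ℤ) : ℚ) • y)
        (Submodule.add_mem _ hz (localTubeSpan_intCast_smul_mem Δ hy _)) ?_ ?_ ?_
      · rw [(hPy m t).2, htA, ht]
        push_cast
        module
      · rw [(hPy m t).2, htA, map_add, map_smul, LinearMap.add_apply, LinearMap.smul_apply, htA,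
          map_smul, LinearMap.smul_apply, hB.self_eq_zero, smul_eq_mul, smul_eq_mul, mul_zero,
          mul_zero, add_zero]
      · rw [map_add, map_smul, LinearMap.add_apply, LinearMap.smul_apply, hzβ, hyx, smul_eq_mul]
        push_cast
        ring
    · -- `k = -m`: apply `(T_y²)^{m}`, which subtracts `2mA y`
      refine localTubeSpan_reach_of_reach_apply Γ (Γ.pow_mem hgy m) ?_
      refine hP _ (z - (((m : ℤ) * A : ℤ) : ℚ) • y)
        (Submodule.sub_mem _ hz (localTubeSpan_intCast_smul_mem Δ hy _)) ?_ ?_ ?_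
      · rw [(hPy m t).1, htA, ht]
        push_cast
        module
      · rw [(hPy m t).1, htA, map_sub, map_smul, LinearMap.sub_apply, LinearMap.smul_apply, htA,
          map_smul, LinearMap.smul_apply, hB.self_eq_zero, smul_eq_mul, smul_eq_mul, mul_zero,
          mul_zero, sub_zero]
      · rw [map_sub, map_smul, LinearMap.sub_apply, LinearMap.smul_apply, hzβ, hyx, smul_eq_mul]
        push_cast
        ring
  · -- `A ↦ A + 4kβ` by powers of `T_x²`
    intro A β k hP t z hz ht htA hzβ
    have htx : B t x = 2 * β := by
      rw [ht, map_add, map_smul, LinearMap.add_apply, LinearMap.smul_apply, hB.self_eq_zero, hzβ,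
        smul_eq_mul, zero_add]
    rcases Int.eq_nat_or_neg k with ⟨m, rfl | rfl⟩
    · -- `k = m`: apply `(T_x²)^{m}`, which subtracts `4mβ x`
      refine localTubeSpan_reach_of_reach_apply Γ (Γ.pow_mem hgx m) ?_
      refine hP _ (z - ((2 * (m : ℤ) * β : ℤ) : ℚ) • x)
        (Submodule.sub_mem _ hz (localTubeSpan_intCast_smul_mem Δ hx _)) ?_ ?_ ?_
      · rw [(hPx m t).1, htx, ht]
        push_cast
        module
      · rw [(hPx m t).1, htx, map_sub, map_smul, LinearMap.sub_apply, LinearMap.smul_apply, htA,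
          map_smul, LinearMap.smul_apply, hxy, smul_eq_mul, smul_eq_mul]
        push_cast
        ring
      · rw [map_sub, map_smul, LinearMap.sub_apply, LinearMap.smul_apply, hzβ, hB.self_eq_zero,
          smul_eq_mul, mul_zero, sub_zero]
    · -- `k = -m`: apply `(T_x²)^{-m}`, which adds `4mβ x`
      refine localTubeSpan_reach_of_reach_apply Γ (Γ.pow_mem (Γ.inv_mem hgx) m) ?_
      refine hP _ (z + ((2 * (m : ℤ) * β : ℤ) : ℚ) • x)
        (Submodule.add_mem _ hz (localTubeSpan_intCast_smul_mem Δ hx _)) ?_ ?_ ?_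
      · rw [(hPx m t).2, htx, ht]
        push_cast
        module
      · rw [(hPx m t).2, htx, map_add, map_smul, LinearMap.add_apply, LinearMap.smul_apply, htA,
          map_smul, LinearMap.smul_apply, hxy, smul_eq_mul, smul_eq_mul]
        push_cast
        ring
      · rw [map_add, map_smul, LinearMap.add_apply, LinearMap.smul_apply, hzβ, hB.self_eq_zero,
          smul_eq_mul, mul_zero, add_zero]
  · -- base `(1, 0)`
    intro t z hz ht htA hzβ
    refine localTubeSpan_reach_of_one_zero_local B Δ Γ hB hxy hpair hz ht
      (by rw [htA, Int.cast_one]) ?_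
    rw [ht, map_add, map_smul, LinearMap.add_apply, LinearMap.smul_apply, hB.self_eq_zero, hzβ,
      Int.cast_zero, smul_zero, add_zero]
  · -- base `(-1, 0)`
    intro t z hz ht htA hzβ
    refine localTubeSpan_reach_of_neg_one_zero_local B Δ Γ hB hxy hpair hsq hx hz ht
      (by rw [htA, Int.cast_neg, Int.cast_one]) ?_
    rw [ht, map_add, map_smul, LinearMap.add_apply, LinearMap.smul_apply, hB.self_eq_zero, hzβ,
      Int.cast_zero, smul_zero, add_zero]

end ReachLocal

end Summit.HodgeConjecture.HodgeConjecture.Theorems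

end
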